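import Summits.BirchSwinnertonDyer.BirchSwinnertonDyer.Theorems.ThetaPartnerAtTwoSignedControlAtTwoPlusHondaTransportEngine
import Summits.BirchSwinnertonDyer.Rank1Residual.Additive.SignedTwistLocalGalois
import Summits.BirchSwinnertonDyer.Rank1Residual.Additive.PadicClosureCyclotomicGalois
import Literature.NumberTheory.EllipticCurves.CyclotomicZpExtensionLocalGeneratorProofs
import Literature.NumberTheory.EllipticCurves.PAdicBSD
import HarnessLib

/-!
# Route `ThetaPartnerAtTwo` (TP2), crux K3 `SignedKatoDivisibilityUpToAtTwo` (stmt-BirchSwinnertonDyer-20308 / K3P′ 25631),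
# line `colemanrat` v12 — the LOCAL CYCLOTOMIC VARIABLE: a local lift `g` of the normalised generator `γ` acting on the
# `p`-power roots of unity by `ζ ↦ ζ^{1+p^e}` (`= ζ⁵` at `p = 2`), in both currencies (`ℚ_v`/`closureEmb` and `ℚ_[p]`/`ι` via `Φ`)

Width seat `bsd-wall-tp2-p2x-w4` g0 (cell `bsd-wall`). HONEST FRAMING: theorems only (no definition, no named fact, no
instance, no `sorry`); Galois bookkeeping; closes no item; K3 / K3P′ are NOT settled and BSD is NOT proved by any of this.

## Why

In the registered PUB stub `stub_katoLayerErlTwo` (CORE_pair) and in its character-value sockets CORE_χ / CORE_χ^prim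
(`CoreChi.core_fin_of_coreChi`, `CoreChi.coreChi_of_coreChiPrim`) the local element `g ∈ Γ_{ℚ_v}` is ∃-bound with the single
property `κ.IsTopGenerator (resGalOfEmb (closureEmb ℚ_v) g)`, and (ERL_χ) evaluates Kurihara's element
`P_{n,d_n}(z) = Σ_{j<2ⁿ} ⟨z, gʲ•d_n⟩ (1+T)ʲ` at `T = χ(5) − 1`: `χ(P_n) = Σ_j ⟨z, gʲ•d_n⟩ χ(5)ʲ`
(`CoreChi.tsum_coeff_pairingSum_mul_pow_eq_sum`). The kernel (R3) theorems (`HondaLog.sum_mul_ptLogΩ_act_plusPoint_eq`,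
`PlusLayer.sum_mul_ptLogΩ_smul_plusHondaPoint_eq`), Kato's value law and Birch's formula are sums over `τ_a ∈ Γ_{ℚ₂}` with
`τ_a ζ_{2^{n+2}} = ζ_{2^{n+2}}^a`, `a ∈ (ℤ/2^{n+2})ˣ = {±5ʲ}` (`HondaLogChi.sum_mulChar_eq_sum_pow_five_of_even`). The two
enumerations match iff `gʲ` acts on `μ_{2^{n+2}}` as `τ_{±5ʲ}`, i.e. iff `χ_cyc(g) = ±5`. This file supplies that `g`, for every
`p`: a local element with `κ(res g) = 1` AND `χ_p(g) = 1 + p^e = cyclotomicGenerator p` EXACTLY, over the completion `ℚ_v`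
(`closureEmb`) and over Mathlib's model `ℚ_[p]` (any `ι`), together with its action `gʲ•ζ = ζ^{(1+p^e)ʲ}` on `μ_{p^∞}` and the
transport `Φ h Φ⁻¹` of the K4 engine (`SignedEC.transportAut*`, `modelMap_smul`), so that ONE `g` serves the crux's `∃ g` (over
`ℚ_v`) and the (R3) log sums (over `ℚ_[2]`, `zeta 2 m`).

## What is here

* §1 `isTopGenerator_resGalOfEmb_of_cyclotomicCharacter_eq` (any `p`, any `ℚ`-field `E`, any `ι : ℚ̄ → Ē`): for the cyclotomic `κ`
  and a normalised generator `γ` in the cyclotomic variable (`κ γ = 1`, `χ_p(γ)·ζ = 1+p^e` with `ζ` torsion), every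
  `g ∈ Γ_E` with `χ_p(g) = 1+p^e` has `κ(res_ι g) = 1` (`χ_p ∘ res_ι = χ_p`, `ker χ_p·μ ≤ ker κ`);
  `exists_padic_isTopGenerator_cyclotomicCharacter_eq` (over `ℚ_[p]`, from `SignedTwist.cyclotomicCharacter_padic_surjective`) and
  `exists_adicCompletion_isTopGenerator_cyclotomicCharacter_eq` (over `ℚ_v`, `v ∣ p`, `closureEmb`, from
  `adicCompletion_rat_exists_mem_absInertia_cyclotomicCharacter_eq`).
* §2 `smul_eq_pow_of_cyclotomicCharacter_eq` / `pow_smul_eq_pow_of_cyclotomicCharacter_eq`: `χ_p(g) = c` (`c : ℕ`) ⇒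
  `gʲ • ζ = ζ^{cʲ}` for every `p`-power root of unity `ζ ∈ K̄`; for the tree's tower `zeta p m ∈ ℚ̄_p`:
  `pow_smul_zeta_eq_pow`, and `smul_eq_smul_of_smul_zeta_eq` (elements with the same action on `ζ_{p^m}` agree on `ℚ_p(ζ_{p^m})`,
  `PadicCyclotomicTower.stab`).
* §3 transport along `Φ : Ē ≃ₐ[K] Ē'` over `φ : E ≃+* E'` (K4 engine): `transportAut_model_mul/_pow`, `cyclotomicCharacter_transportAut_model`
  (`χ_p(Φ h Φ⁻¹) = χ_p(h)`), `isTopGenerator_resGalOfEmb_transportAut_model`, `modelMap_pow_smul` (`T (hʲ • P) = (Φ h Φ⁻¹)ʲ • T P`).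
* §4 `exists_localVariable_two`: at `p = 2`, for the model data `(Φ, φ, ι)` of `SignedEC.exists_model_padic_adicCompletion` (as displayed by
  `PlusLayer.plusHondaSystemTwo_adicCompletion_withLog`): `∃ g₀ ∈ Γ_{ℚ_[2]}, g ∈ Γ_{ℚ_v}` with `κ.IsTopGenerator (resGalOfEmb ι g₀)`,
  `κ.IsTopGenerator (resGalOfEmb (closureEmb ℚ_v) g)`, `g₀ʲ • zeta 2 m = (zeta 2 m)^(5ʲ)`, `χ₂(g₀) = χ₂(g) = 5`, and
  `Φ_* (g₀ʲ • P) = gʲ • Φ_* P` on `E(ℚ̄₂)`.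

References: [SerreAbelianLadic1968] Ch. I §1.2; [SerreLocalFields1979] Ch. IV §4 Prop. 17; [Washington1997] §13.1, Ch. 14 p. 321;
[Kobayashi2003] §2 p. 4, §8.4, (8.23); [MazurTateTeitelbaum1986Invent] §I.13 (`γ = 1 + p^e`).
-/

set_option autoImplicit false
-- the Theorems namespace of this sub repeats the summit name by design (D-0017 nested layout)
set_option linter.dupNamespace false

noncomputable section

open scoped Classical NumberField

open Field IsDedekindDomain NumberField WeierstrassCurve
  Literature.NumberTheory.GaloisRepresentations Literature.NumberTheory.EllipticCurves
  Literature.NumberTheory.EllipticCurves.Kobayashi2003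
  Summit.BirchSwinnertonDyer.Rank1Residual.Additive.LocalTransport
  Summit.BirchSwinnertonDyer.Rank1Residual.Additive

universe u

namespace Summit.BirchSwinnertonDyer.BirchSwinnertonDyer.Theorems.SignedKatoOffTwo.LocalVar

/-! ## §1 A local lift of `γ` in the cyclotomic variable: `κ(res g) = 1` and `χ_p(g) = 1 + p^e` -/

section TopGenerator

variable {p : ℕ} [Fact p.Prime] {κ : ZpExtension ℚ p} {γ : absoluteGaloisGroup ℚ}

/-- **`χ_p(g) = 1 + p^e` forces `κ(res g) = 1`.** For the cyclotomic `ℤ_p`-extension `κ` of `ℚ` (`ker κ = χ_p⁻¹(μ(ℤ_p))`), a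
normalised topological generator `γ` (`κ γ = 1`) in the cyclotomic variable (`χ_p(γ)·ζ = 1 + p^e`, `ζ` of finite order), a field
`E ⊇ ℚ`, an embedding `ι : ℚ̄ → Ē` and `g ∈ Γ_E` with `χ_p(g) = 1 + p^e`: `κ(res_ι g) = 1`. Indeed `χ_p(res_ι g) = χ_p(g) = χ_p(γ)·ζ`,
so `res_ι g · γ⁻¹ ∈ χ_p⁻¹(μ) = ker κ`. [cite: Washington1997, §13.1] [cite: MazurTateTeitelbaum1986Invent, §I.13] -/
theorem isTopGenerator_resGalOfEmb_of_cyclotomicCharacter_eq (hκ : κ.IsCyclotomic) (hγ : κ.IsTopGenerator γ)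
    (hvar : IsCyclotomicVariable p γ) {E : Type} [Field E] [Algebra ℚ E]
    (ι : AlgebraicClosure ℚ →ₐ[ℚ] AlgebraicClosure E) {g : absoluteGaloisGroup E}
    (hg : ((GaloisRep.cyclotomicCharacter E p g : ℤ_[p]ˣ) : ℤ_[p]) = (cyclotomicGenerator p : ℤ_[p])) :
    κ.IsTopGenerator (resGalOfEmb ι g) := by
  obtain ⟨ζ, hζ, hu⟩ := hvar
  -- `χ_p (res g) = χ_p g = χ_p γ * ζ`
  have hres : GaloisRep.cyclotomicCharacter ℚ p (resGalOfEmb ι g) = GaloisRep.cyclotomicCharacter ℚ p γ * ζ := by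
    rw [SignedTwist.cyclotomicCharacter_resGalOfEmb ι p g]
    exact Units.ext (by rw [hg, ← hu])
  -- hence `res g · γ⁻¹ ∈ χ_p⁻¹(μ(ℤ_p)) = ker κ`
  have hmem : resGalOfEmb ι g * γ⁻¹ ∈ κ.kerSubgroup := by
    have h : resGalOfEmb ι g * γ⁻¹ ∈
        (CommGroup.torsion ℤ_[p]ˣ).comap (GaloisRep.cyclotomicCharacter ℚ p).toMonoidHom := by
      rw [Subgroup.mem_comap]
      change GaloisRep.cyclotomicCharacter ℚ p (_ * γ⁻¹) ∈ CommGroup.torsion ℤ_[p]ˣ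
      rw [map_mul, map_inv, hres, mul_inv_cancel_comm, CommGroup.mem_torsion]
      exact hζ
    unfold ZpExtension.IsCyclotomic at hκ
    rw [hκ]
    exact h
  have hq : κ (resGalOfEmb ι g * γ⁻¹) = 1 := ZpExtension.mem_kerSubgroup.mp hmem
  rw [map_mul, map_inv, mul_inv_eq_one] at hq
  rw [ZpExtension.IsTopGenerator, hq]
  exact hγ

/-- **A local lift of `γ` in the cyclotomic variable over the model `ℚ_[p]`**: for the cyclotomic `κ`, a normalised generator `γ` in
the cyclotomic variable and ANY embedding `ι : ℚ̄ → ℚ̄_p`, there is `g ∈ Γ_{ℚ_p}` with `κ(res_ι g) = 1` and `χ_p(g) = 1 + p^e`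
(`χ_p : Γ_{ℚ_p} → ℤ_pˣ` is onto, `SignedTwist.cyclotomicCharacter_padic_surjective`). [cite: SerreLocalFields1979, Ch. IV §4, Prop. 17]
[cite: Washington1997, §13.1] -/
theorem exists_padic_isTopGenerator_cyclotomicCharacter_eq (hκ : κ.IsCyclotomic) (hγ : κ.IsTopGenerator γ)
    (hvar : IsCyclotomicVariable p γ) (ι : AlgebraicClosure ℚ →ₐ[ℚ] AlgebraicClosure ℚ_[p]) :
    ∃ g : absoluteGaloisGroup ℚ_[p], κ.IsTopGenerator (resGalOfEmb ι g) ∧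
      ((GaloisRep.cyclotomicCharacter ℚ_[p] p g : ℤ_[p]ˣ) : ℤ_[p]) = (cyclotomicGenerator p : ℤ_[p]) := by
  obtain ⟨ζ, hζ, hu⟩ := hvar
  obtain ⟨g, hg⟩ := SignedTwist.cyclotomicCharacter_padic_surjective p (GaloisRep.cyclotomicCharacter ℚ p γ * ζ)
  have hg' : ((GaloisRep.cyclotomicCharacter ℚ_[p] p g : ℤ_[p]ˣ) : ℤ_[p]) = (cyclotomicGenerator p : ℤ_[p]) := by
    rw [hg, hu]
  exact ⟨g, isTopGenerator_resGalOfEmb_of_cyclotomicCharacter_eq hκ hγ ⟨ζ, hζ, hu⟩ ι hg', hg'⟩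

/-- **A local lift of `γ` in the cyclotomic variable over the completion `ℚ_v`, `v ∣ p`** (chosen embedding `closureEmb ℚ_v`): there is
`g ∈ Γ_{ℚ_v}` with `κ(res g) = 1` and `χ_p(g) = 1 + p^e` (`χ_p(I_{ℚ_v}) = ℤ_pˣ`, `adicCompletion_rat_exists_mem_absInertia_cyclotomicCharacter_eq`).
This sharpens the tree's `ZpExtension.IsCyclotomic.exists_isTopGenerator_resGalOfEmb_adicCompletion` (`κ(res g) = 1` only) by pinning
the action of `g` on `μ_{p^∞}`. [cite: SerreLocalFields1979, Ch. IV §4, Prop. 17] [cite: Washington1997, §13.1] -/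
theorem exists_adicCompletion_isTopGenerator_cyclotomicCharacter_eq (hκ : κ.IsCyclotomic) (hγ : κ.IsTopGenerator γ)
    (hvar : IsCyclotomicVariable p γ) (v : HeightOneSpectrum (𝓞 ℚ)) (hv : (p : 𝓞 ℚ) ∈ v.asIdeal) :
    ∃ g : absoluteGaloisGroup (v.adicCompletion ℚ),
      κ.IsTopGenerator (resGalOfEmb (closureEmb (K := ℚ) (v.adicCompletion ℚ)) g) ∧
      ((GaloisRep.cyclotomicCharacter (v.adicCompletion ℚ) p g : ℤ_[p]ˣ) : ℤ_[p]) = (cyclotomicGenerator p : ℤ_[p]) := by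
  have hp : p.Prime := Fact.out
  -- `primesEquiv v = p`
  have hv' : (Rat.HeightOneSpectrum.primesEquiv v : ℕ) = p := by
    have h1 : Rat.HeightOneSpectrum.natGenerator v ∣ p := by
      rw [Rat.HeightOneSpectrum.natGenerator_dvd_iff, Ideal.mem_map_of_equiv]
      exact ⟨p, hv, map_natCast _ p⟩
    exact (Nat.prime_dvd_prime_iff_eq (Rat.HeightOneSpectrum.prime_natGenerator v) hp).mp h1
  obtain ⟨ζ, hζ, hu⟩ := hvar
  obtain ⟨g, -, hg⟩ := adicCompletion_rat_exists_mem_absInertia_cyclotomicCharacter_eq p v hv'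
    (GaloisRep.cyclotomicCharacter ℚ p γ * ζ)
  have hg' : ((GaloisRep.cyclotomicCharacter (v.adicCompletion ℚ) p g : ℤ_[p]ˣ) : ℤ_[p]) = (cyclotomicGenerator p : ℤ_[p]) := by
    rw [hg, hu]
  exact ⟨g, isTopGenerator_resGalOfEmb_of_cyclotomicCharacter_eq hκ hγ ⟨ζ, hζ, hu⟩ _ hg', hg'⟩

end TopGenerator

/-! ## §2 The action on the `p`-power roots of unity: `χ_p(g) = c ⇒ gʲ • ζ = ζ^{cʲ}` -/

section Action

variable {K : Type u} [Field K] (p : ℕ) [Fact p.Prime] [NeZero (p : K)]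

/-- **`χ_p(g) = c ⇒ g • ζ = ζ^c`** for every `ζ ∈ K̄` with `ζ^{p^k} = 1` (`c : ℕ`; the defining property of the cyclotomic character,
`GaloisRep.cyclotomicCharacter_spec`, with `(c mod p^k)` lifted to `c`). [cite: SerreAbelianLadic1968, Ch. I §1.2] -/
theorem smul_eq_pow_of_cyclotomicCharacter_eq {g : absoluteGaloisGroup K} {c : ℕ}
    (hg : ((GaloisRep.cyclotomicCharacter K p g : ℤ_[p]ˣ) : ℤ_[p]) = (c : ℤ_[p])) (k : ℕ) (t : AlgebraicClosure K)
    (ht : t ^ p ^ k = 1) : g • t = t ^ c := by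
  rw [GaloisRep.cyclotomicCharacter_spec K p g t ht, hg, map_natCast, ZMod.val_natCast]
  conv_rhs => rw [← Nat.mod_add_div c (p ^ k), pow_add, pow_mul, ht, one_pow, mul_one]

/-- **`χ_p(g) = c ⇒ gʲ • ζ = ζ^{cʲ}`** for every `p`-power root of unity `ζ ∈ K̄`. [cite: SerreAbelianLadic1968, Ch. I §1.2] -/
theorem pow_smul_eq_pow_of_cyclotomicCharacter_eq {g : absoluteGaloisGroup K} {c : ℕ}
    (hg : ((GaloisRep.cyclotomicCharacter K p g : ℤ_[p]ˣ) : ℤ_[p]) = (c : ℤ_[p])) (k : ℕ) (t : AlgebraicClosure K)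
    (ht : t ^ p ^ k = 1) (j : ℕ) : g ^ j • t = t ^ c ^ j := by
  induction j with
  | zero => rw [pow_zero, one_smul, pow_zero, pow_one]
  | succ j ih =>
    have ht' : (t ^ c ^ j) ^ p ^ k = 1 := by rw [← pow_mul, mul_comm, pow_mul, ht, one_pow]
    rw [pow_succ', mul_smul, ih, smul_eq_pow_of_cyclotomicCharacter_eq p hg k _ ht', ← pow_mul, ← pow_succ]

/-- **The tower `zeta p m ∈ ℚ̄_p`**: `χ_p(g) = c ⇒ gʲ • ζ_{p^m} = ζ_{p^m}^{cʲ}` for the tree's compatible system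
`PadicCyclotomicTower.zeta`. [cite: Kobayashi2003, §8.4] -/
theorem pow_smul_zeta_eq_pow {g : absoluteGaloisGroup ℚ_[p]} {c : ℕ}
    (hg : ((GaloisRep.cyclotomicCharacter ℚ_[p] p g : ℤ_[p]ˣ) : ℤ_[p]) = (c : ℤ_[p])) (m j : ℕ) :
    g ^ j • PadicCyclotomicTower.zeta p m = PadicCyclotomicTower.zeta p m ^ c ^ j :=
  pow_smul_eq_pow_of_cyclotomicCharacter_eq p hg m _ (PadicCyclotomicTower.isPrimitiveRoot_zeta p m).pow_eq_one j

/-- `χ_p(g) = c ⇒ g • ζ_{p^m} = ζ_{p^m}^c`. [cite: Kobayashi2003, §8.4] -/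
theorem smul_zeta_eq_pow {g : absoluteGaloisGroup ℚ_[p]} {c : ℕ}
    (hg : ((GaloisRep.cyclotomicCharacter ℚ_[p] p g : ℤ_[p]ˣ) : ℤ_[p]) = (c : ℤ_[p])) (m : ℕ) :
    g • PadicCyclotomicTower.zeta p m = PadicCyclotomicTower.zeta p m ^ c := by
  simpa using pow_smul_zeta_eq_pow p hg m 1

/-- **Elements with the same action on `ζ_{p^m}` agree on `ℚ_p(ζ_{p^m})`**: if `σ • ζ_{p^m} = τ • ζ_{p^m}` then `σ • x = τ • x` for every
`x ∈ layer p m = ℚ_p(ζ_{p^m})` (`τ⁻¹σ ∈ Stab(ζ_{p^m})` fixes the layer, `PadicCyclotomicTower.smul_eq_self_of_mem_stab`). [cite: Kobayashi2003, §8.4] -/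
theorem smul_eq_smul_of_smul_zeta_eq {σ τ : absoluteGaloisGroup ℚ_[p]} {m : ℕ}
    (h : σ • PadicCyclotomicTower.zeta p m = τ • PadicCyclotomicTower.zeta p m) {x : PadicAlgCl p}
    (hx : x ∈ PadicCyclotomicTower.layer p m) : σ • x = τ • x := by
  have hmem : τ⁻¹ * σ ∈ PadicCyclotomicTower.stab p m := by
    rw [PadicCyclotomicTower.mem_stab_iff, mul_smul, h, inv_smul_smul]
  have hfix := PadicCyclotomicTower.smul_eq_self_of_mem_stab hmem hx
  rw [mul_smul] at hfix
  calc σ • x = τ • (τ⁻¹ • (σ • x)) := (smul_inv_smul τ _).symm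
    _ = τ • x := by rw [hfix]

end Action

/-! ## §3 Transport along an isomorphism of algebraic closures (the K4 engine `Φ h Φ⁻¹`) -/

section Transport

variable {K : Type u} [Field K] {E : Type u} [Field E] [Algebra K E] {E' : Type u} [Field E'] [Algebra K E']
  (Φ : AlgebraicClosure E ≃ₐ[K] AlgebraicClosure E') (φ : E ≃+* E')
  (hf : ∀ y : E, Φ (algebraMap E (AlgebraicClosure E) y) = algebraMap E' (AlgebraicClosure E') (φ y))

include hf in
/-- `Φ (h₁h₂) Φ⁻¹ = (Φ h₁ Φ⁻¹)(Φ h₂ Φ⁻¹)`. [cite: SerreGaloisCohomology1997, II.§1.1] -/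
theorem transportAut_model_mul (h₁ h₂ : absoluteGaloisGroup E) :
    transportAut Φ.toRingEquiv (h₁ * h₂) (SignedEC.modelFix Φ φ hf _) =
      transportAut Φ.toRingEquiv h₁ (SignedEC.modelFix Φ φ hf _) * transportAut Φ.toRingEquiv h₂ (SignedEC.modelFix Φ φ hf _) := by
  apply AlgEquiv.ext
  intro x
  change (show AlgebraicClosure E' ≃ₐ[E'] AlgebraicClosure E' from
      transportAut Φ.toRingEquiv (h₁ * h₂) (SignedEC.modelFix Φ φ hf (h₁ * h₂))) x =
    (show AlgebraicClosure E' ≃ₐ[E'] AlgebraicClosure E' from transportAut Φ.toRingEquiv h₁ (SignedEC.modelFix Φ φ hf h₁))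
      ((show AlgebraicClosure E' ≃ₐ[E'] AlgebraicClosure E' from transportAut Φ.toRingEquiv h₂ (SignedEC.modelFix Φ φ hf h₂)) x)
  rw [SignedEC.transportAut_model_apply, SignedEC.transportAut_model_apply, SignedEC.transportAut_model_apply,
    AlgEquiv.symm_apply_apply]
  rfl

include hf in
/-- `Φ hʲ Φ⁻¹ = (Φ h Φ⁻¹)ʲ`. [cite: SerreGaloisCohomology1997, II.§1.1] -/
theorem transportAut_model_pow (h : absoluteGaloisGroup E) (j : ℕ) :
    transportAut Φ.toRingEquiv (h ^ j) (SignedEC.modelFix Φ φ hf _) = transportAut Φ.toRingEquiv h (SignedEC.modelFix Φ φ hf _) ^ j := by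
  induction j with
  | zero =>
    rw [pow_zero, pow_zero]
    apply AlgEquiv.ext
    intro x
    rw [SignedEC.transportAut_model_apply]
    change Φ (Φ.symm x) = x
    exact Φ.apply_symm_apply x
  | succ j ih => rw [pow_succ, transportAut_model_mul Φ φ hf, ih, ← pow_succ]

/-- **`Φ h Φ⁻¹` acts on the roots of unity of `Ē'` as `h` does on those of `Ē`**: if `h • t = t^c` for all `t ∈ Ē` with `t^N = 1`, then
`(Φ h Φ⁻¹) • t' = t'^c` for all `t' ∈ Ē'` with `t'^N = 1`. [cite: SerreGaloisCohomology1997, II.§1.1] -/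
theorem transportAut_model_smul_eq_pow {h : absoluteGaloisGroup E} (hh) {N c : ℕ}
    (hc : ∀ t : AlgebraicClosure E, t ^ N = 1 → h • t = t ^ c) (t' : AlgebraicClosure E') (ht' : t' ^ N = 1) :
    transportAut Φ.toRingEquiv h hh • t' = t' ^ c := by
  rw [Field.absoluteGaloisGroup.smul_def]
  change (show AlgebraicClosure E' ≃ₐ[E'] AlgebraicClosure E' from transportAut Φ.toRingEquiv h hh) t' = _
  rw [SignedEC.transportAut_model_apply]
  have ht : (Φ.symm t') ^ N = 1 := by rw [← map_pow, ht', map_one]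
  have h1 : (show AlgebraicClosure E ≃ₐ[E] AlgebraicClosure E from h) (Φ.symm t') = h • Φ.symm t' := rfl
  rw [h1, hc _ ht, map_pow, AlgEquiv.apply_symm_apply]

variable (p : ℕ) [Fact p.Prime]

/-- **`χ_p(Φ h Φ⁻¹) = χ_p(h)`** (in characteristic `0`): `Φ` maps `μ_{p^∞}(Ē)` onto `μ_{p^∞}(Ē')` and conjugation transports the action
(uniqueness of the cyclotomic character, `modularCyclotomicCharacter.unique`). [cite: SerreAbelianLadic1968, Ch. I §1.2] -/
theorem cyclotomicCharacter_transportAut_model [NeZero (p : E)] [NeZero (p : E')] (h : absoluteGaloisGroup E) (hh) :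
    GaloisRep.cyclotomicCharacter E' p (transportAut Φ.toRingEquiv h hh) = GaloisRep.cyclotomicCharacter E p h := by
  refine Units.ext (PadicInt.ext_of_toZModPow.mp fun n => ?_)
  rw [GaloisRep.cyclotomicCharacter_apply E', cyclotomicCharacter.toZModPow]
  symm
  refine modularCyclotomicCharacter.unique (AlgebraicClosure E') _ _ (fun t ht => ?_)
  have ht' : ((t : (AlgebraicClosure E')ˣ) : AlgebraicClosure E') ^ p ^ n = 1 := by
    have := congrArg Units.val ((mem_rootsOfUnity _ t).mp ht)
    simpa using this
  change transportAut Φ.toRingEquiv h hh • ((t : (AlgebraicClosure E')ˣ) : AlgebraicClosure E') = _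
  exact transportAut_model_smul_eq_pow Φ hh (fun s hs => GaloisRep.cyclotomicCharacter_spec E p h s hs) _ ht'

variable (ι : AlgebraicClosure K →ₐ[K] AlgebraicClosure E) (ι' : AlgebraicClosure K →ₐ[K] AlgebraicClosure E')
  (hcompat : ∀ z : AlgebraicClosure K, ι' z = Φ (ι z))

include hcompat in
/-- **`κ(res_{ι'}(Φ h Φ⁻¹)) = κ(res_ι h)`**: a normalised local generator over the model stays one after transport
(`SignedEC.resGalOfEmb_transportAut_model`). [cite: SerreGaloisCohomology1997, II.§1.1] -/
theorem isTopGenerator_resGalOfEmb_transportAut_model (κ : ZpExtension K p) (h : absoluteGaloisGroup E) (hh)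
    (hgen : κ.IsTopGenerator (resGalOfEmb ι h)) :
    κ.IsTopGenerator (resGalOfEmb ι' (transportAut Φ.toRingEquiv h hh)) := by
  rw [ZpExtension.IsTopGenerator, SignedEC.resGalOfEmb_transportAut_model Φ ι ι' hcompat]
  exact hgen

variable (W : WeierstrassCurve K) (T : localPoints W E →+ localPoints W E')
  (hT : ∀ P : localPoints W E, T P =
    WeierstrassCurve.Affine.Point.map (W' := W) (Φ : AlgebraicClosure E →ₐ[K] AlgebraicClosure E')
      (show (W.baseChange (AlgebraicClosure E)).toAffine.Point from P))

include hf hT in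
/-- **`Φ_* (hʲ • P) = (Φ h Φ⁻¹)ʲ • Φ_* P`** on `E(Ē)` (`SignedEC.modelMap_smul` + `transportAut_model_pow`). [cite: SilvermanAEC2009, VIII.§1] -/
theorem modelMap_pow_smul (h : absoluteGaloisGroup E) (j : ℕ) (P : localPoints W E) :
    T (h ^ j • P) = transportAut Φ.toRingEquiv h (SignedEC.modelFix Φ φ hf _) ^ j • T P := by
  rw [SignedEC.modelMap_smul Φ W T hT (h ^ j) (SignedEC.modelFix Φ φ hf _), transportAut_model_pow Φ φ hf]

end Transport

/-! ## §4 `p = 2`: ONE local variable element for the crux (`ℚ_v`, `closureEmb`) and for the (R3) log sums (`ℚ_[2]`, `zeta 2 m`) -/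

section Two

open Rat.HeightOneSpectrum

/-- **The local cyclotomic variable at `2`, in both currencies.** For the cyclotomic `ℤ₂`-extension `κ` of `ℚ`, a normalised
generator `γ` in the cyclotomic variable (`κ γ = 1`, `χ₂(γ) = ±5`), a place `v ∋ 2`, and model data `Φ : ℚ̄₂ ≃ₐ[ℚ] ℚ̄_v` over
`φ : ℚ_[2] ≃+* ℚ_v` with an embedding `ι : ℚ̄ → ℚ̄₂` such that `closureEmb ℚ_v = Φ ∘ ι` (the data of
`SignedEC.exists_model_padic_adicCompletion`, displayed by `PlusLayer.plusHondaSystemTwo_adicCompletion_withLog`), there are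
`g₀ ∈ Γ_{ℚ₂}` and `g = Φ g₀ Φ⁻¹ ∈ Γ_{ℚ_v}` with: `κ.IsTopGenerator (resGalOfEmb ι g₀)`, `κ.IsTopGenerator (resGalOfEmb (closureEmb ℚ_v) g)`
(the binder `hg` of CORE_pair / CORE_χ), `χ₂(g₀) = χ₂(g) = 5`, `g₀ʲ • ζ_{2^m} = ζ_{2^m}^{5ʲ}` on the tree's tower `zeta 2 m` (so `g₀ʲ`
is a `τ_{5ʲ}` of the (R3) theorems), and `Φ_*(g₀ʲ • P) = gʲ • Φ_* P` for every `P ∈ E(ℚ̄₂)` and every `W/ℚ` (so the pairing-sum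
enumeration `gʲ • d_n` of the crux's `d = Φ_* d₀` is `Φ_*(g₀ʲ • d₀ n)`). [cite: Kobayashi2003, §2 p. 4, §8.4, (8.23)]
[cite: MazurTateTeitelbaum1986Invent, §I.13] -/
theorem exists_localVariable_two {κ : ZpExtension ℚ 2} (hκ : κ.IsCyclotomic) {γ : absoluteGaloisGroup ℚ}
    (hγ : κ.IsTopGenerator γ) (hvar : IsCyclotomicVariable 2 γ)
    (v : HeightOneSpectrum (𝓞 ℚ)) (Φ : AlgebraicClosure ℚ_[2] ≃ₐ[ℚ] AlgebraicClosure (v.adicCompletion ℚ))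
    (φ : ℚ_[2] ≃+* v.adicCompletion ℚ)
    (hf : ∀ y : ℚ_[2], Φ (algebraMap ℚ_[2] (AlgebraicClosure ℚ_[2]) y) =
      algebraMap (v.adicCompletion ℚ) (AlgebraicClosure (v.adicCompletion ℚ)) (φ y))
    (ι : AlgebraicClosure ℚ →ₐ[ℚ] AlgebraicClosure ℚ_[2])
    (hcompat : ∀ z, closureEmb (K := ℚ) (v.adicCompletion ℚ) z = Φ (ι z)) :
    ∃ (g₀ : absoluteGaloisGroup ℚ_[2]) (g : absoluteGaloisGroup (v.adicCompletion ℚ)),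
      g = transportAut Φ.toRingEquiv g₀ (SignedEC.modelFix Φ φ hf g₀) ∧
      κ.IsTopGenerator (resGalOfEmb ι g₀) ∧
      κ.IsTopGenerator (resGalOfEmb (closureEmb (K := ℚ) (v.adicCompletion ℚ)) g) ∧
      ((GaloisRep.cyclotomicCharacter ℚ_[2] 2 g₀ : ℤ_[2]ˣ) : ℤ_[2]) = 5 ∧
      ((GaloisRep.cyclotomicCharacter (v.adicCompletion ℚ) 2 g : ℤ_[2]ˣ) : ℤ_[2]) = 5 ∧
      (∀ m j : ℕ, g₀ ^ j • PadicCyclotomicTower.zeta 2 m = PadicCyclotomicTower.zeta 2 m ^ 5 ^ j) ∧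
      (∀ (k j : ℕ) (t : AlgebraicClosure (v.adicCompletion ℚ)), t ^ 2 ^ k = 1 → g ^ j • t = t ^ 5 ^ j) ∧
      (∀ (W : WeierstrassCurve ℚ) (j : ℕ) (P : localPoints W ℚ_[2]),
        (show localPoints W (v.adicCompletion ℚ) from
          WeierstrassCurve.Affine.Point.map (W' := W)
            (Φ : AlgebraicClosure ℚ_[2] →ₐ[ℚ] AlgebraicClosure (v.adicCompletion ℚ))
            (show (W.baseChange (AlgebraicClosure ℚ_[2])).toAffine.Point from (g₀ ^ j • P))) =
          g ^ j • (show localPoints W (v.adicCompletion ℚ) from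
            WeierstrassCurve.Affine.Point.map (W' := W)
              (Φ : AlgebraicClosure ℚ_[2] →ₐ[ℚ] AlgebraicClosure (v.adicCompletion ℚ))
              (show (W.baseChange (AlgebraicClosure ℚ_[2])).toAffine.Point from P))) := by
  haveI : NeZero ((2 : ℕ) : v.adicCompletion ℚ) :=
    ⟨by rw [← map_natCast (algebraMap ℚ (v.adicCompletion ℚ))]; exact (map_ne_zero _).mpr (by norm_num)⟩
  obtain ⟨g₀, hgen₀, hχ₀⟩ := exists_padic_isTopGenerator_cyclotomicCharacter_eq hκ hγ hvar ι
  have h5 : (cyclotomicGenerator 2 : ℤ_[2]) = ((5 : ℕ) : ℤ_[2]) := by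
    rw [cyclotomicGenerator, cyclotomicExponent]; norm_num
  have hχ₀' : ((GaloisRep.cyclotomicCharacter ℚ_[2] 2 g₀ : ℤ_[2]ˣ) : ℤ_[2]) = ((5 : ℕ) : ℤ_[2]) := by rw [hχ₀, h5]
  set g := transportAut Φ.toRingEquiv g₀ (SignedEC.modelFix Φ φ hf g₀) with hgdef
  have hχ : GaloisRep.cyclotomicCharacter (v.adicCompletion ℚ) 2 g = GaloisRep.cyclotomicCharacter ℚ_[2] 2 g₀ :=
    cyclotomicCharacter_transportAut_model Φ 2 g₀ _
  have hχ' : ((GaloisRep.cyclotomicCharacter (v.adicCompletion ℚ) 2 g : ℤ_[2]ˣ) : ℤ_[2]) = ((5 : ℕ) : ℤ_[2]) := by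
    rw [hχ, hχ₀']
  refine ⟨g₀, g, rfl, hgen₀, isTopGenerator_resGalOfEmb_transportAut_model Φ 2 ι _ hcompat κ g₀ _ hgen₀,
    by rw [hχ₀']; norm_num, by rw [hχ']; norm_num, fun m j ↦ pow_smul_zeta_eq_pow 2 hχ₀' m j,
    fun k j t ht ↦ pow_smul_eq_pow_of_cyclotomicCharacter_eq 2 hχ' k t ht j, fun W j P ↦ ?_⟩
  let T : localPoints W ℚ_[2] →+ localPoints W (v.adicCompletion ℚ) :=
    WeierstrassCurve.Affine.Point.map (W' := W) (Φ : AlgebraicClosure ℚ_[2] →ₐ[ℚ] AlgebraicClosure (v.adicCompletion ℚ))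
  have hT : ∀ P : localPoints W ℚ_[2], T P =
      WeierstrassCurve.Affine.Point.map (W' := W) (Φ : AlgebraicClosure ℚ_[2] →ₐ[ℚ] AlgebraicClosure (v.adicCompletion ℚ))
        (show (W.baseChange (AlgebraicClosure ℚ_[2])).toAffine.Point from P) := fun _ ↦ rfl
  have key := modelMap_pow_smul Φ φ hf W T hT g₀ j P
  rw [hT, hT] at key
  exact key

end Two

end Summit.BirchSwinnertonDyer.BirchSwinnertonDyer.Theorems.SignedKatoOffTwo.LocalVar

end
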